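import Literature.AlgebraicGeometry.Motives.AbelianVarietyInducedAction
import Literature.AlgebraicGeometry.Motives.AbelianVarietyEquivariantFactorCharacter
import Literature.AlgebraicGeometry.Motives.AbelianVarietyPermutationPowerFixedPart
import HarnessLib

/-!
# Isotypical components and `Hom`-characters of an induced action `X = Ind_H^G Y`:
# `|H| · 2 dim B_W(Ind_H^G Y) = Σ_{h ∈ H} c_W(h) χ_Y(h)` (Frobenius reciprocity `⟨Ind χ_Y, W⟩_G = ⟨χ_Y, Res W⟩_H`),
# `χ_B(ρ(g)) = Σ_{t ∈ T^g} χ_B(ι_t ρ(g) π_t)` on `Hom(−, B)`, and `B_G(Ind_H^G Y) ∼ B_H(Y)`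

Sequel of `Motives/AbelianVarietyInducedAction`: `G` acts on a finite set `T`, `X = ⊕_{t ∈ T} Y_t` is a power of the abelian
variety `Y` (bicone `b`, `Σ_t π_t ≫ ι_t = 𝟙`) with an action `ρ : G → End X` PERMUTING THE SUMMANDS (`ι_t ≫ ρ(g) ≫ π_u = 0`
for `u ≠ g t`, hypothesis `hρ`; Serre §3.3 / §7.1 Prop. 19); for `T` transitive, `t₀ ∈ T`, `H = Stab(t₀)` and the stabiliser
action `α(h) = ι_{t₀} ≫ ρ(h) ≫ π_{t₀}` of `H` on `Y`, `X = Ind_H^G Y`.  Frobenius reciprocity against class functions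
(`|H| Σ_g c(g) χ_X(g) = |G| Σ_h c(h) χ_Y(h)`, the prequel's `Imprimitive.card_stabilizer_mul_sum_mul_trace_eq`) is applied here to

* §1 the COEFFICIENTS `c_W` OF THE RATIONAL CENTRAL IDEMPOTENTS (`|G| e_W = Σ_g c_W(g) g`, the hypothesis `hc` of the tree's
  isotypical decomposition `Motives/AbelianVarietyGroupActionIsotypicalDecomposition`): `c_W(g) = |G| · (e_W)_g`
  (`intCast_isotypicalCoeff_eq`) and **`c_W(x⁻¹ g x) = c_W(g)`** (`isotypicalCoeff_conj_eq`: `e_W` is central, Lange–Rodríguez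
  (2.23): `(e_W)_g = (χ(1)/|G|) tr_{ℚ(χ)/ℚ} χ(g⁻¹)` is a class function);
* §2 THE ISOTYPICAL COMPONENTS OF AN INDUCED ACTION (`B_W(X) = Im u_W`, `u_W = Σ_g c_W(g) ρ(g)`, `ℓ` invertible in `K`, any
  field): **`|H| · 2 dim B_W(Ind_H^G Y) = Σ_{h ∈ H} c_W(h) Tr(α(h) | T_ℓ Y)`** (`card_stabilizer_mul_two_mul_dim_isotypical_eq_sum`)
  — Lange–Rodríguez Prop. 2.9.3 "`dim B_W = ½ ⟨ρ_r, W⟩`" for `ρ_r = Ind_H^G χ_Y`, evaluated by Frobenius reciprocity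
  `⟨Ind_H^G χ_Y, |G| e_W⟩_G = ⟨χ_Y, Res_H (|G| e_W)⟩_H` (Serre Thm. 13) — with the VANISHING CRITERION
  **`B_W(Ind_H^G Y) = 0 ⟺ Σ_{h ∈ H} c_W(h) χ_Y(h) = 0`** (`dim_isotypical_eq_zero_iff_of_induced`) and, for the TRIVIAL stabiliser
  action (all `ι_{t₀} ρ(h) π_{t₀} = 𝟙`: the coset permutation power `Y ⊗ ℤ[G/H]`, Serre §3.3 Ex. 2),
  **`|H| · dim B_W(Y^{G/H}) = (Σ_{h ∈ H} c_W(h)) · dim Y`** (`card_stabilizer_mul_dim_isotypical_eq_of_transfer_eq_id`;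
  `Σ_{h ∈ H} c_W(h) = |G| |H| ⟨Res_H e_W, 1_H⟩`);
* §3 THE `Hom`-SIDE CHARACTERS `χ_B(w) = tr_ℤ(w ∘ − | Hom(X, B))` of Kani–Rosen (`Motives/AbelianVarietyIdempotentRelations`;
  any field, no auxiliary prime): **`χ_B(ρ(g)) = Σ_{t ∈ T^g} χ_B(ι_t ρ(g) π_t)`**, the conjugation rule, Serre's Thm. 12
  **`|H| · χ_B(ρ(g)) = Σ_{x ∈ G, (x⁻¹gx)t₀ = t₀} χ_B(ι_{t₀} ρ(x⁻¹gx) π_{t₀})`**, Frobenius reciprocity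
  **`|H| Σ_g c(g) χ_B(ρ(g)) = |G| Σ_h c(h) χ_B(α(h))`**, hence **`rk_ℤ Hom(B_G(Ind_H^G Y), B) = rk_ℤ Hom(B_H(Y), B)` for every `B`**
  (`finrank_hom_image_normG_eq_of_induced`), **`|H| · rk_ℤ Hom(B_W(Ind_H^G Y), B) = Σ_{h ∈ H} c_W(h) χ_B(α(h))`**, and over a
  PERFECT field (the tree's Hom-count criterion `isIsogenous_iff_forall_finrank_hom_eq'`) the isogeny
  **`B_G(Ind_H^G Y) ∼ B_H(Y)`** (`isIsogenous_image_normG_image_norm_stabilizer`: "`(Ind_H^G W)^G ≅ W^H`").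

Everything is a theorem; `c`, `u` (isotypical data), `ρ`, `hρ`, `α`, `hα` are hypotheses in the formats of the cited tree files.

## References

* [SerreLinearRepresentations1977] J.-P. Serre, *Linear Representations of Finite Groups*, GTM 42 (1977): §3.3 Thm. 12 and Ex. 2
  (`ℚ[G/H] = Ind_H^G 1`), §7.1 Prop. 19, §7.2 Thm. 13 (Frobenius reciprocity `⟨ψ, Res φ⟩_H = ⟨Ind ψ, φ⟩_G`) and Remark (1),
  §2.6 Thm. 8 (isotypical projectors).  Held: `book:serre1977-linear-representations-finite-groups`, PDF pp. 30–31, 50–52.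
* [LangeRodriguez2022] H. Lange, R. E. Rodríguez, *Decomposition of Jacobians by Prym Varieties*, LNM 2310 (2022), §2.8
  (2.21)–(2.23) (`e_W`, PDF p. 40), §2.9.1 Thm. 2.9.1 and Prop. 2.9.3 (PDF pp. 43, 46: "`dim B = 0` iff `⟨ρ, W⟩ = 0`"), §3.5.
* [KaniRosen1989] E. Kani, M. Rosen, *Idempotent relations and factors of Jacobians*, Math. Ann. 284 (1989), §2 (the characters
  `χ` of `End⁰`), §3 Thm. B.
* [Milne1986AbelianVarieties] J. S. Milne, *Abelian varieties*, in Cornell–Silverman (1986), §12 p. 122 and Prop. 12.9.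
* [MumfordAV1970] D. Mumford, *Abelian Varieties* (1970), §19 Thm. 3 (p. 176), Thm. 4 (p. 180).
-/

noncomputable section

open CategoryTheory CategoryTheory.Limits MulAction
open Literature.NumberTheory.DiophantineGeometry
open Literature.RepresentationTheory.FiniteGroups

universe u

namespace Literature.AlgebraicGeometry.Motives

namespace AbelianVariety

variable {K : Type u} [Field K]

/-! ## §1 The coefficients of `|G| e_W` are integral class functions -/

section ClassFunction

variable {G : Type} [Group G] [Fintype G] {c : ratCharIdempotents G → G → ℤ}
  (hc : ∀ e : ratCharIdempotents G,
    (Fintype.card G : ℚ) • (e : MonoidAlgebra ℚ G) = ∑ g, (c e g : ℚ) • MonoidAlgebra.of ℚ G g)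

include hc

/-- **`c_W(g) = |G| · (e_W)_g`**: the integral coefficients of the hypothesis `|G| e_W = Σ_g c_W(g) g` are `|G|` times the
coefficients of the rational central idempotent. [cite: LangeRodriguez2022, §2.8 (2.23) (PDF p. 40)] -/
theorem intCast_isotypicalCoeff_eq (e : ratCharIdempotents G) (g : G) :
    (c e g : ℚ) = Fintype.card G * (e : MonoidAlgebra ℚ G).coeff g := by
  classical
  have h := congrArg (fun y : MonoidAlgebra ℚ G ↦ y.coeff g) (hc e)
  simp only [MonoidAlgebra.coeff_smul_apply, MonoidAlgebra.coeff_sum, Finsupp.finsetSum_apply, MonoidAlgebra.of_apply,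
    MonoidAlgebra.coeff_single, Finsupp.single_apply, smul_eq_mul, mul_ite, mul_one, mul_zero,
    Finset.sum_ite_eq' Finset.univ g, Finset.mem_univ, if_true] at h
  exact h.symm

/-- **`c_W` is a class function: `c_W(x⁻¹ g x) = c_W(g)`** — `e_W` is CENTRAL in `ℚ[G]` (its coefficient
`(χ(1)/|G|) tr_{ℚ(χ)/ℚ}(χ(g⁻¹))` is a class function), so `g e_W = e_W g` compares the coefficients at `g x`.
[cite: LangeRodriguez2022, §2.8 (2.21)–(2.23) (PDF p. 40)] [cite: SerreLinearRepresentations1977, §2.6 Thm. 8 (the `p_i` commute with `ρ`)] -/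
theorem isotypicalCoeff_conj_eq (e : ratCharIdempotents G) (g x : G) : c e (x⁻¹ * g * x) = c e g := by
  have hcen := Subalgebra.mem_center_iff.1 (ratCharIdempotents_mem_center e) (MonoidAlgebra.single x 1)
  have h := congrArg (fun y : MonoidAlgebra ℚ G ↦ y.coeff (g * x)) hcen
  simp only [MonoidAlgebra.coeff_single_mul_apply, MonoidAlgebra.coeff_mul_single_apply, one_mul, mul_one,
    mul_inv_cancel_right] at h
  rw [← mul_assoc] at h
  have h' := intCast_isotypicalCoeff_eq hc e (x⁻¹ * g * x)
  rw [h, ← intCast_isotypicalCoeff_eq hc e g] at h'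
  exact_mod_cast h'

end ClassFunction

/-! ## §2 The isotypical components of an induced action: `|H| · 2 dim B_W(Ind_H^G Y) = Σ_{h ∈ H} c_W(h) χ_Y(h)` -/

namespace Imprimitive

section Isotypical

variable (ℓ : ℕ) [Fact ℓ.Prime] {Y : AbelianVariety K} {T : Type} [Fintype T] (b : Bicone (fun _ : T ↦ Y))
  {G : Type} [Group G] [Fintype G] [MulAction G T] [IsPretransitive G T] (ρ : G →* End b.pt) (t₀ : T)
  [Fintype (stabilizer G t₀)] (α : stabilizer G t₀ →* End Y)
  {c : ratCharIdempotents G → G → ℤ}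
  (hc : ∀ e : ratCharIdempotents G,
    (Fintype.card G : ℚ) • (e : MonoidAlgebra ℚ G) = ∑ g, (c e g : ℚ) • MonoidAlgebra.of ℚ G g)
  {u : ratCharIdempotents G → (b.pt ⟶ b.pt)} (hu : ∀ e, End.of (u e) = ∑ g, c e g • ρ g)

include hc hu

/-- **`|H| · 2 dim B_W(Ind_H^G Y) = Σ_{h ∈ H} c_W(h) Tr(α(h) | T_ℓ Y)`** for every isotypical component `B_W(X) = Im u_W`,
`u_W = Σ_g c_W(g) ρ(g)`, of an induced action (`T` transitive, `H = Stab(t₀)`, `α(h) = ι_{t₀} ρ(h) π_{t₀}`, `ℓ` invertible in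
`K`, any field): `|G| · 2 dim B_W(X) = Σ_g c_W(g) χ_X(g) = ⟨|G| e_W, Ind_H^G χ_Y⟩`, and Frobenius reciprocity moves the class
function `c_W` to `H` — "`dim B_W = ½ ⟨ρ_r, W⟩`" computed on the inducing subgroup.
[cite: LangeRodriguez2022, §2.9.1 Prop. 2.9.3 (PDF p. 46)] [cite: SerreLinearRepresentations1977, §7.2 Thm. 13 and §3.3 Thm. 12] -/
theorem card_stabilizer_mul_two_mul_dim_isotypical_eq_sum (hb : ∑ t, b.π t ≫ b.ι t = 𝟙 b.pt)
    (hρ : ∀ (g : G) (t u : T), g • t ≠ u → b.ι t ≫ End.asHom (ρ g) ≫ b.π u = 0) (hℓ : (ℓ : K) ≠ 0)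
    (hα : ∀ h : stabilizer G t₀, End.asHom (α h) = b.ι t₀ ≫ End.asHom (ρ h) ≫ b.π t₀) (e : ratCharIdempotents G) :
    ((Fintype.card (stabilizer G t₀) * (2 * (image (u e)).dim) : ℕ) : ℤ_[ℓ]) =
      ∑ h : stabilizer G t₀, (c e h : ℤ_[ℓ]) * LinearMap.trace ℤ_[ℓ] (Y.tateModule ℓ) (tateModuleMap ℓ (End.asHom (α h))) := by
  have h1 := card_mul_two_mul_dim_isotypical_eq_sum ℓ ρ hc hu hℓ e
  have h2 := card_stabilizer_mul_sum_mul_trace_eq ℓ b ρ t₀ α hb hρ hℓ hα (fun g ↦ (c e g : ℤ_[ℓ]))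
    (fun g x ↦ by rw [isotypicalCoeff_conj_eq hc e g x])
  rw [← h1] at h2
  have hG : (Fintype.card G : ℤ_[ℓ]) ≠ 0 := Nat.cast_ne_zero.2 Fintype.card_ne_zero
  refine mul_left_cancel₀ hG ?_
  rw [← h2]
  push_cast
  ring

/-- **Vanishing criterion: `B_W(Ind_H^G Y) = 0 ⟺ Σ_{h ∈ H} c_W(h) Tr(α(h) | T_ℓ Y) = 0`** — the `W`-isotypical component of the
induced action is present iff `⟨χ_Y, Res_H (|G| e_W)⟩_H ≠ 0` ("`dim B = 0` if and only if `⟨ρ, W⟩ = 0`", with `⟨Ind χ_Y, W⟩`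
evaluated on `H`). [cite: LangeRodriguez2022, §2.9.1 Thm. 2.9.1 and Prop. 2.9.3 (ii) (PDF pp. 43, 46)]
[cite: SerreLinearRepresentations1977, §7.2 Thm. 13] -/
theorem dim_isotypical_eq_zero_iff_of_induced (hb : ∑ t, b.π t ≫ b.ι t = 𝟙 b.pt)
    (hρ : ∀ (g : G) (t u : T), g • t ≠ u → b.ι t ≫ End.asHom (ρ g) ≫ b.π u = 0) (hℓ : (ℓ : K) ≠ 0)
    (hα : ∀ h : stabilizer G t₀, End.asHom (α h) = b.ι t₀ ≫ End.asHom (ρ h) ≫ b.π t₀) (e : ratCharIdempotents G) :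
    (image (u e)).dim = 0 ↔
      ∑ h : stabilizer G t₀, (c e h : ℤ_[ℓ]) * LinearMap.trace ℤ_[ℓ] (Y.tateModule ℓ) (tateModuleMap ℓ (End.asHom (α h)))
        = 0 := by
  rw [← card_stabilizer_mul_two_mul_dim_isotypical_eq_sum ℓ b ρ t₀ α hc hu hb hρ hℓ hα e, Nat.cast_eq_zero, mul_eq_zero,
    mul_eq_zero]
  have : Fintype.card (stabilizer G t₀) ≠ 0 := Fintype.card_ne_zero
  omega

omit [Fact ℓ.Prime] in
/-- **The coset permutation power: `|H| · dim B_W(Y^{G/H}) = (Σ_{h ∈ H} c_W(h)) · dim Y`** when the stabiliser acts TRIVIALLY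
on the summand (`ι_{t₀} ρ(h) π_{t₀} = 𝟙` for `h ∈ H` — e.g. the permutation powers `ι_s ≫ ρ(g) = ι_{g s}` of
`Motives/AbelianVarietyPermutationPower*`, `X = Y ⊗ ℤ[G/H] = Ind_H^G 1 ⊗ Y`): `χ_Y(h) = 2 dim Y` for all `h`, so the multiplicity
is `(|G|/|H|) ⟨Res_H e_W, 1_H⟩ = dim e_W ℚ[G/H]` (Serre Ex. 7.2: `χ_{G/H} = Ind_H^G 1`).
[cite: SerreLinearRepresentations1977, §3.3 Example 2 and Ex. 7.2] [cite: LangeRodriguez2022, §2.9.1 Prop. 2.9.3 (PDF p. 46)] -/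
theorem card_stabilizer_mul_dim_isotypical_eq_of_transfer_eq_id (hb : ∑ t, b.π t ≫ b.ι t = 𝟙 b.pt)
    (hρ : ∀ (g : G) (t u : T), g • t ≠ u → b.ι t ≫ End.asHom (ρ g) ≫ b.π u = 0)
    (h1 : ∀ h : stabilizer G t₀, b.ι t₀ ≫ End.asHom (ρ h) ≫ b.π t₀ = 𝟙 Y) (e : ratCharIdempotents G) :
    ((Fintype.card (stabilizer G t₀) * (image (u e)).dim : ℕ) : ℤ) = (∑ h : stabilizer G t₀, c e h) * Y.dim := by
  obtain ⟨ℓ', hℓ'p, hℓ'⟩ := exists_prime_natCast_ne_zero (K := K)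
  haveI : Fact ℓ'.Prime := ⟨hℓ'p⟩
  obtain ⟨α', hα'⟩ := exists_stabilizerAction b ρ hb hρ t₀
  have key := card_stabilizer_mul_two_mul_dim_isotypical_eq_sum ℓ' b ρ t₀ α' hc hu hb hρ hℓ' hα' e
  have htr : ∀ h : stabilizer G t₀,
      LinearMap.trace ℤ_[ℓ'] (Y.tateModule ℓ') (tateModuleMap ℓ' (End.asHom (α' h))) = ((2 * Y.dim : ℕ) : ℤ_[ℓ']) := by
    intro h
    rw [hα' h, h1 h, trace_tateModuleMap_id_eq_two_mul_dim ℓ' Y hℓ']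
  simp_rw [htr] at key
  rw [← Finset.sum_mul] at key
  have key' : (((Fintype.card (stabilizer G t₀) * (image (u e)).dim : ℕ) : ℤ) : ℤ_[ℓ']) * 2 =
      ((((∑ h : stabilizer G t₀, c e h) * Y.dim : ℤ)) : ℤ_[ℓ']) * 2 := by
    push_cast at key ⊢
    linear_combination key
  exact_mod_cast (mul_left_injective₀ (two_ne_zero' ℤ_[ℓ']) key' : _)

end Isotypical

/-! ## §3 The `Hom`-side characters of an induced action and `B_G(Ind_H^G Y) ∼ B_H(Y)` -/

section HomCharacter

variable {Y : AbelianVariety K} (B : AbelianVariety K) {T : Type} [Fintype T] (b : Bicone (fun _ : T ↦ Y))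
  {G : Type} [Group G] [MulAction G T] (ρ : G →* End b.pt)

/-- **`χ_B(ρ(g)) = Σ_{t ∈ T^g} χ_B(ι_t ρ(g) π_t)`** for `χ_B(w) = tr_ℤ(w ∘ − | Hom(−, B))` (any field): the block formula on
`Hom(X, B) = ⊕_t Hom(Y_t, B)` and the vanishing of the off-orbit blocks. [cite: SerreLinearRepresentations1977, §3.3 Thm. 12 (proof)]
[cite: KaniRosen1989, §2 (the characters `χ`)] -/
theorem trace_leftComp_asHom_eq_sum_filter [DecidableEq T] (hb : ∑ t, b.π t ≫ b.ι t = 𝟙 b.pt)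
    (hρ : ∀ (g : G) (t u : T), g • t ≠ u → b.ι t ≫ End.asHom (ρ g) ≫ b.π u = 0) (g : G) :
    LinearMap.trace ℤ (b.pt ⟶ B) (Preadditive.leftComp B (End.asHom (ρ g))).toIntLinearMap =
      ∑ t ∈ Finset.univ.filter (fun t ↦ g • t = t),
        LinearMap.trace ℤ (Y ⟶ B) (Preadditive.leftComp B (b.ι t ≫ End.asHom (ρ g) ≫ b.π t)).toIntLinearMap := by
  rw [trace_leftComp_permPower_eq_sum B b hb, Finset.sum_filter]
  refine Finset.sum_congr rfl fun t _ ↦ ?_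
  split_ifs with h
  · rfl
  · rw [hρ g t t h, show (Preadditive.leftComp B (0 : Y ⟶ Y)).toIntLinearMap = 0 from
      LinearMap.ext fun f ↦ by change (0 : Y ⟶ Y) ≫ f = 0; exact zero_comp, map_zero]

/-- **Conjugation rule on `Hom(−, B)`**: if `g` fixes `x t`, `χ_B(ι_{xt} ρ(g) π_{xt}) = χ_B(ι_t ρ(x⁻¹gx) π_t)` (the blocks are
conjugate by the transfer isomorphism `φ_{x,t}`, and `χ_B` is a trace). [cite: SerreLinearRepresentations1977, §3.3 Thm. 12 (proof)]
[cite: KaniRosen1989, §2] -/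
theorem trace_leftComp_transfer_smul_eq (hb : ∑ t, b.π t ≫ b.ι t = 𝟙 b.pt)
    (hρ : ∀ (g : G) (t u : T), g • t ≠ u → b.ι t ≫ End.asHom (ρ g) ≫ b.π u = 0) {g x : G} {t : T}
    (hx : g • x • t = x • t) :
    LinearMap.trace ℤ (Y ⟶ B) (Preadditive.leftComp B (b.ι (x • t) ≫ End.asHom (ρ g) ≫ b.π (x • t))).toIntLinearMap =
      LinearMap.trace ℤ (Y ⟶ B)
        (Preadditive.leftComp B (b.ι t ≫ End.asHom (ρ (x⁻¹ * g * x)) ≫ b.π t)).toIntLinearMap := by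
  have h1 := ι_comp_asHom_eq b ρ hb hρ x t
  have h2 := ι_comp_asHom_eq b ρ hb hρ g (x • t)
  rw [hx] at h2
  have key : b.ι t ≫ End.asHom (ρ (x⁻¹ * g * x)) ≫ b.π t =
      (b.ι t ≫ End.asHom (ρ x) ≫ b.π (x • t)) ≫ (b.ι (x • t) ≫ End.asHom (ρ g) ≫ b.π (x • t)) ≫
        (b.ι (x • t) ≫ End.asHom (ρ x⁻¹) ≫ b.π t) := by
    rw [asHom_map_mul_eq_comp, asHom_map_mul_eq_comp]
    simp only [Category.assoc]
    rw [reassoc_of% h1, reassoc_of% h2]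
  rw [key, trace_leftComp_comp_comm B, Category.assoc, transfer_inv_comp_transfer b ρ hb hρ x t]
  erw [Category.comp_id]

/-- **Serre's Theorem 12 on `Hom(−, B)`**: for `T` transitive, `t₀ ∈ T`,
**`|Stab(t₀)| · χ_B(ρ(g)) = Σ_{x ∈ G, (x⁻¹gx) t₀ = t₀} χ_B(ι_{t₀} ρ(x⁻¹ g x) π_{t₀})`** (any field, `G` finite).
[cite: SerreLinearRepresentations1977, §3.3 Thm. 12] [cite: KaniRosen1989, §2] -/
theorem card_stabilizer_mul_trace_leftComp_asHom_eq_sum [Fintype G] [DecidableEq T] [IsPretransitive G T]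
    (hb : ∑ t, b.π t ≫ b.ι t = 𝟙 b.pt)
    (hρ : ∀ (g : G) (t u : T), g • t ≠ u → b.ι t ≫ End.asHom (ρ g) ≫ b.π u = 0) (t₀ : T) (g : G) :
    (Nat.card (stabilizer G t₀) : ℤ) *
        LinearMap.trace ℤ (b.pt ⟶ B) (Preadditive.leftComp B (End.asHom (ρ g))).toIntLinearMap =
      ∑ x : G, if (x⁻¹ * g * x) • t₀ = t₀ then
        LinearMap.trace ℤ (Y ⟶ B) (Preadditive.leftComp B (b.ι t₀ ≫ End.asHom (ρ (x⁻¹ * g * x)) ≫ b.π t₀)).toIntLinearMap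
        else 0 := by
  classical
  set F : T → ℤ := fun t ↦ if g • t = t then
    LinearMap.trace ℤ (Y ⟶ B) (Preadditive.leftComp B (b.ι t ≫ End.asHom (ρ g) ≫ b.π t)).toIntLinearMap else 0 with hF
  have hcond : ∀ x : G, (x⁻¹ * g * x) • t₀ = t₀ ↔ g • x • t₀ = x • t₀ := fun x ↦ by
    rw [mul_smul, mul_smul, inv_smul_eq_iff]
  have hFx : ∀ x : G, (if (x⁻¹ * g * x) • t₀ = t₀ then
      LinearMap.trace ℤ (Y ⟶ B) (Preadditive.leftComp B (b.ι t₀ ≫ End.asHom (ρ (x⁻¹ * g * x)) ≫ b.π t₀)).toIntLinearMap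
      else 0) = F (x • t₀) := by
    intro x
    by_cases h : g • x • t₀ = x • t₀
    · rw [if_pos ((hcond x).2 h)]
      simp only [hF, h, ↓reduceIte]
      exact (trace_leftComp_transfer_smul_eq B b ρ hb hρ h).symm
    · rw [if_neg (fun h' ↦ h ((hcond x).1 h'))]
      simp only [hF, h, ↓reduceIte]
  -- `x ↦ x t₀` is `|Stab(t₀)|`-to-one
  have hfib : ∀ t : T, (Finset.univ.filter fun x : G ↦ x • t₀ = t).card = Nat.card (stabilizer G t₀) := by
    intro t
    obtain ⟨x₀, hx₀⟩ := exists_smul_eq G t₀ t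
    have e : {x : G // x • t₀ = t} ≃ stabilizer G t₀ :=
      { toFun := fun x ↦ ⟨x₀⁻¹ * x.1, by rw [mem_stabilizer_iff, mul_smul, x.2, ← hx₀, inv_smul_smul]⟩
        invFun := fun h ↦ ⟨x₀ * (h : G), by rw [mul_smul, mem_stabilizer_iff.mp h.2, hx₀]⟩
        left_inv := fun x ↦ Subtype.ext (mul_inv_cancel_left x₀ x.1)
        right_inv := fun h ↦ Subtype.ext (inv_mul_cancel_left x₀ (h : G)) }
    rw [← Nat.card_congr e, Nat.card_eq_fintype_card, Fintype.card_subtype]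
  have hsum : ∑ x : G, F (x • t₀) = Nat.card (stabilizer G t₀) • ∑ t : T, F t := by
    rw [← Finset.sum_fiberwise Finset.univ (fun x : G ↦ x • t₀) (fun x ↦ F (x • t₀)), Finset.smul_sum]
    refine Finset.sum_congr rfl fun t _ ↦ ?_
    rw [Finset.sum_congr rfl (fun x hx ↦ by rw [(Finset.mem_filter.mp hx).2] :
        ∀ x ∈ Finset.univ.filter (fun x : G ↦ x • t₀ = t), F (x • t₀) = F t), Finset.sum_const, hfib t]
  rw [Finset.sum_congr rfl fun x _ ↦ hFx x, hsum, nsmul_eq_mul, trace_leftComp_asHom_eq_sum_filter B b ρ hb hρ g,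
    Finset.sum_filter]

variable [Fintype G] [IsPretransitive G T] (t₀ : T) [Fintype (stabilizer G t₀)] (α : stabilizer G t₀ →* End Y)

/-- **Frobenius reciprocity on `Hom(−, B)`**: for a class function `c : G → ℤ` and the stabiliser action
`α(h) = ι_{t₀} ρ(h) π_{t₀}`, **`|H| · Σ_{g ∈ G} c(g) χ_B(ρ(g)) = |G| · Σ_{h ∈ H} c(h) χ_B(α(h))`** (any field).
[cite: SerreLinearRepresentations1977, §7.2 Thm. 13 and Remark (1)] [cite: KaniRosen1989, §2] -/
theorem card_stabilizer_mul_sum_mul_trace_leftComp_eq (hb : ∑ t, b.π t ≫ b.ι t = 𝟙 b.pt)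
    (hρ : ∀ (g : G) (t u : T), g • t ≠ u → b.ι t ≫ End.asHom (ρ g) ≫ b.π u = 0)
    (hα : ∀ h : stabilizer G t₀, End.asHom (α h) = b.ι t₀ ≫ End.asHom (ρ h) ≫ b.π t₀)
    (c : G → ℤ) (hcl : ∀ g x : G, c (x⁻¹ * g * x) = c g) :
    (Fintype.card (stabilizer G t₀) : ℤ) *
        ∑ g, c g * LinearMap.trace ℤ (b.pt ⟶ B) (Preadditive.leftComp B (End.asHom (ρ g))).toIntLinearMap =
      (Fintype.card G : ℤ) *
        ∑ h : stabilizer G t₀, c h * LinearMap.trace ℤ (Y ⟶ B) (Preadditive.leftComp B (End.asHom (α h))).toIntLinearMap := by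
  classical
  set F : G → ℤ := fun k ↦ if k • t₀ = t₀ then
    c k * LinearMap.trace ℤ (Y ⟶ B) (Preadditive.leftComp B (b.ι t₀ ≫ End.asHom (ρ k) ≫ b.π t₀)).toIntLinearMap else 0
    with hF
  have hR : ∑ h : stabilizer G t₀, c h * LinearMap.trace ℤ (Y ⟶ B)
      (Preadditive.leftComp B (End.asHom (α h))).toIntLinearMap = ∑ k, F k := by
    rw [hF, ← Finset.sum_filter, Finset.sum_subtype (Finset.univ.filter fun k : G ↦ k • t₀ = t₀)
      (p := fun k ↦ k ∈ stabilizer G t₀) (fun k ↦ by simp [mem_stabilizer_iff])]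
    exact Finset.sum_congr rfl fun h _ ↦ by rw [hα h]
  have hL : (Fintype.card (stabilizer G t₀) : ℤ) *
      ∑ g, c g * LinearMap.trace ℤ (b.pt ⟶ B) (Preadditive.leftComp B (End.asHom (ρ g))).toIntLinearMap =
      ∑ x : G, ∑ k, F k := by
    rw [Finset.mul_sum]
    have h1 : ∀ g : G, (Fintype.card (stabilizer G t₀) : ℤ) *
        (c g * LinearMap.trace ℤ (b.pt ⟶ B) (Preadditive.leftComp B (End.asHom (ρ g))).toIntLinearMap) =
        ∑ x : G, F (x⁻¹ * g * x) := by
      intro g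
      rw [mul_left_comm, ← Nat.card_eq_fintype_card, card_stabilizer_mul_trace_leftComp_asHom_eq_sum B b ρ hb hρ t₀ g,
        Finset.mul_sum]
      refine Finset.sum_congr rfl fun x _ ↦ ?_
      rw [hF]
      dsimp only
      rw [hcl g x]
      split_ifs <;> simp
    rw [Finset.sum_congr rfl fun g _ ↦ h1 g, Finset.sum_comm]
    refine Finset.sum_congr rfl fun x _ ↦ ?_
    exact Fintype.sum_equiv (MulAut.conj x⁻¹).toEquiv _ _ fun g ↦ by simp [mul_assoc]
  rw [hL, hR, Finset.sum_const, Finset.card_univ, nsmul_eq_mul]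

/-- **`rk_ℤ Hom(B_G(Ind_H^G Y), B) = rk_ℤ Hom(B_H(Y), B)` for every abelian variety `B`** (any field): `|G| · rk Hom(B_G(X), B)
= Σ_g χ_B(ρ(g))` (`N_G² = |G| N_G`, `χ_B(u) = a · rk Hom(Im u, B)` for `u² = a u`), `|H| · rk Hom(B_H(Y), B) = Σ_h χ_B(α(h))`, and
Frobenius reciprocity against `1` — the fixed parts `B_G(X) = Im Σ_g ρ(g)` and `B_H(Y) = Im Σ_h α(h)` have the same `Hom`-counts.
[cite: SerreLinearRepresentations1977, §7.2 Thm. 13] [cite: KaniRosen1989, §2 and §3 Thm. B] [cite: Milne1986AbelianVarieties, §12 p. 122] -/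
theorem finrank_hom_image_normG_eq_of_induced (hb : ∑ t, b.π t ≫ b.ι t = 𝟙 b.pt)
    (hρ : ∀ (g : G) (t u : T), g • t ≠ u → b.ι t ≫ End.asHom (ρ g) ≫ b.π u = 0)
    (hα : ∀ h : stabilizer G t₀, End.asHom (α h) = b.ι t₀ ≫ End.asHom (ρ h) ≫ b.π t₀)
    {NG : b.pt ⟶ b.pt} (hNG : End.of NG = ∑ g, ρ g) {NH : Y ⟶ Y} (hNH : End.of NH = ∑ h : stabilizer G t₀, α h) :
    Module.finrank ℤ (image NG ⟶ B) = Module.finrank ℤ (image NH ⟶ B) := by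
  have h1 := trace_leftComp_eq_mul_finrank B (normG_comp_normG_eq_card_nsmul ρ hNG)
  have h2 := trace_leftComp_eq_mul_finrank B (normG_comp_normG_eq_card_nsmul α hNH)
  have hNG' : NG = ∑ g, (1 : ℤ) • End.asHom (ρ g) := by
    rw [Finset.sum_congr rfl fun g _ ↦ one_zsmul (End.asHom (ρ g))]; exact hNG
  have hNH' : NH = ∑ h : stabilizer G t₀, (1 : ℤ) • End.asHom (α h) := by
    rw [Finset.sum_congr rfl fun h _ ↦ one_zsmul (End.asHom (α h))]; exact hNH
  have hs1 : LinearMap.trace ℤ (b.pt ⟶ B) (Preadditive.leftComp B NG).toIntLinearMap =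
      ∑ g, 1 * LinearMap.trace ℤ (b.pt ⟶ B) (Preadditive.leftComp B (End.asHom (ρ g))).toIntLinearMap := by
    conv_lhs => rw [hNG']
    rw [trace_leftComp_sum_zsmul]
  have hs2 : LinearMap.trace ℤ (Y ⟶ B) (Preadditive.leftComp B NH).toIntLinearMap =
      ∑ h : stabilizer G t₀, 1 * LinearMap.trace ℤ (Y ⟶ B) (Preadditive.leftComp B (End.asHom (α h))).toIntLinearMap := by
    conv_lhs => rw [hNH']
    rw [trace_leftComp_sum_zsmul]
  rw [hs1] at h1
  rw [hs2] at h2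
  have h3 := card_stabilizer_mul_sum_mul_trace_leftComp_eq B b ρ t₀ α hb hρ hα (fun _ ↦ 1) (fun _ _ ↦ rfl)
  rw [h1, h2] at h3
  have h4 : ((Fintype.card (stabilizer G t₀) * Fintype.card G : ℕ) : ℤ) * Module.finrank ℤ (image NG ⟶ B) =
      ((Fintype.card (stabilizer G t₀) * Fintype.card G : ℕ) : ℤ) * Module.finrank ℤ (image NH ⟶ B) := by
    push_cast
    linear_combination h3
  have hpos : ((Fintype.card (stabilizer G t₀) * Fintype.card G : ℕ) : ℤ) ≠ 0 :=
    Nat.cast_ne_zero.2 (mul_ne_zero Fintype.card_ne_zero Fintype.card_ne_zero)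
  exact_mod_cast mul_left_cancel₀ hpos h4

variable {c : ratCharIdempotents G → G → ℤ}
  (hc : ∀ e : ratCharIdempotents G,
    (Fintype.card G : ℚ) • (e : MonoidAlgebra ℚ G) = ∑ g, (c e g : ℚ) • MonoidAlgebra.of ℚ G g)
  {u : ratCharIdempotents G → (b.pt ⟶ b.pt)} (hu : ∀ e, End.of (u e) = ∑ g, c e g • ρ g)

include hc hu in
/-- **`|H| · rk_ℤ Hom(B_W(Ind_H^G Y), B) = Σ_{h ∈ H} c_W(h) χ_B(α(h))`** for every isotypical component `B_W(X) = Im u_W` and every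
abelian variety `B` (any field): `|G| · rk Hom(B_W, B) = χ_B(u_W) = Σ_g c_W(g) χ_B(ρ(g))`, then Frobenius reciprocity for the
class function `c_W`. [cite: LangeRodriguez2022, §2.9.1 Thm. 2.9.1 and Prop. 2.9.3 (PDF pp. 43, 46)]
[cite: SerreLinearRepresentations1977, §7.2 Thm. 13] [cite: KaniRosen1989, §2] -/
theorem card_stabilizer_mul_finrank_hom_isotypical_eq_sum (hb : ∑ t, b.π t ≫ b.ι t = 𝟙 b.pt)
    (hρ : ∀ (g : G) (t u : T), g • t ≠ u → b.ι t ≫ End.asHom (ρ g) ≫ b.π u = 0)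
    (hα : ∀ h : stabilizer G t₀, End.asHom (α h) = b.ι t₀ ≫ End.asHom (ρ h) ≫ b.π t₀) (e : ratCharIdempotents G) :
    (Fintype.card (stabilizer G t₀) : ℤ) * Module.finrank ℤ (image (u e) ⟶ B) =
      ∑ h : stabilizer G t₀, c e h *
        LinearMap.trace ℤ (Y ⟶ B) (Preadditive.leftComp B (End.asHom (α h))).toIntLinearMap := by
  have h1 := trace_leftComp_eq_mul_finrank B (comp_self_eq_card_nsmul_isotypical ρ hc hu e)
  have hs : LinearMap.trace ℤ (b.pt ⟶ B) (Preadditive.leftComp B (u e)).toIntLinearMap =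
      ∑ g, c e g * LinearMap.trace ℤ (b.pt ⟶ B) (Preadditive.leftComp B (End.asHom (ρ g))).toIntLinearMap := by
    rw [isotypical_eq_sum_zsmul_asHom ρ hu e, trace_leftComp_sum_zsmul]
  rw [hs] at h1
  have h2 := card_stabilizer_mul_sum_mul_trace_leftComp_eq B b ρ t₀ α hb hρ hα (c e)
    (fun g x ↦ isotypicalCoeff_conj_eq hc e g x)
  rw [h1, ← mul_assoc, mul_comm (Fintype.card (stabilizer G t₀) : ℤ), mul_assoc] at h2
  exact mul_left_cancel₀ (Nat.cast_ne_zero.2 Fintype.card_ne_zero) h2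

/-- **`B_G(Ind_H^G Y) ∼ B_H(Y)` over a perfect field** ("`(Ind_H^G W)^G ≅ W^H`" up to isogeny): both Kani–Rosen factors have
`rk Hom(−, B)` equal for every `B` (`finrank_hom_image_normG_eq_of_induced`), and over a perfect field equal `Hom`-counts
characterise the isogeny class (the tree's `isIsogenous_iff_forall_finrank_hom_eq'`).
[cite: SerreLinearRepresentations1977, §7.2 Thm. 13] [cite: KaniRosen1989, §3 Thm. B] [cite: Milne1986AbelianVarieties, §12 p. 122]
[cite: LangeRodriguez2022, §2.9.1 Prop. 2.9.3 and §3.5] -/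
theorem isIsogenous_image_normG_image_norm_stabilizer [PerfectField K] (hb : ∑ t, b.π t ≫ b.ι t = 𝟙 b.pt)
    (hρ : ∀ (g : G) (t u : T), g • t ≠ u → b.ι t ≫ End.asHom (ρ g) ≫ b.π u = 0)
    (hα : ∀ h : stabilizer G t₀, End.asHom (α h) = b.ι t₀ ≫ End.asHom (ρ h) ≫ b.π t₀)
    {NG : b.pt ⟶ b.pt} (hNG : End.of NG = ∑ g, ρ g) {NH : Y ⟶ Y} (hNH : End.of NH = ∑ h : stabilizer G t₀, α h) :
    IsIsogenous (image NG) (image NH) :=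
  isIsogenous_iff_forall_finrank_hom_eq'.2 fun B ↦ finrank_hom_image_normG_eq_of_induced B b ρ t₀ α hb hρ hα hNG hNH

end HomCharacter

end Imprimitive

end AbelianVariety

end Literature.AlgebraicGeometry.Motives
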